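import Summits.CriticalPhenomena.PercolationContinuityZ3.Theorems.PercNearOneGluingNoHeavyLowerTailMajorityGluingQCertSymParts
import HarnessLib

/-!
# Part 10 of 18 of the orbit certificate of the cell `(12,7)` at `c = 157/100`: data and digest (lane prim-rate, constants-miner 1, gen 36; generated by cert/mksym.py)

Support file for the closed crux `NoHeavyLowerTail` (stmt-CriticalPhenomena-4575), majority-gluing line.  The symmetrised certificate of the cell `(12,7)`
(kit j286395, symcert.py) is checked IN PARTS (`…MajorityGluingQCertSymParts`): this file holds part 10 (1 multiplier terms, 1 marginal slacks,
0 rows, 0 squares; 3636 contributions) and its DIGEST `twelveSevenSymP10D` (53 orbit keys), verified by `decide +kernel` (`twelveSevenSymP10_digest`).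
The parts are glued in `…MajorityGluingQCertSymTwelveSeven`.  No sorries. [cite: VandenbergKahn2001, Thm 1.2 (p. 123)]
-/

namespace Summit.CriticalPhenomena.PercolationContinuityZ3.Theorems

namespace HubOnly
namespace QCert

/-- Row representatives of part 10: `(A, X, B, Y, n, masks of f(A,X), f(B,Y), f(A∪B,X∩Y), f(∅,X∪Y))`. -/
def twelveSevenSymP10Rows : List RowE :=
  []

/-- Square representatives of part 10: `(a, b, n, mask₁, mask₂)`. -/
def twelveSevenSymP10Sqs : List SqE :=
  []

/-- **Part 10** of the `(12,7)` orbit certificate at `157/100`. -/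
def twelveSevenSymP10 : SymCert :=
  ⟨⟨12, 7, 157, 100, 1, [], [], []⟩,
    [(1, 316667)],
    [(0, 30, 50000000)],
    [twelveSevenSymP10Rows], [twelveSevenSymP10Sqs]⟩

/-- The digest of part 10: `(orbit key, coefficient total)` in increasing key order (computed by cert/mksym.py, verified below). -/
def twelveSevenSymP10D : List (ℕ × ℤ) :=
  [((4127 : ℕ), (50000000 : ℤ)), (4224, -14630015400), (4351, -10450011000), (4352, -10450011000), (4607, -5225005500), (4608, -5225005500), 
    (5119, -1741668500), (5120, -1741668500), (6143, -348333700), (6144, -348333700), (8191, -31666700), (8192, -31666700), (12320, 200000000), 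
    (12351, 350000000), (28706, 300000000), (28736, 1400000000), (28799, 1050000000), (61478, 200000000), (61486, 50000000), (61506, 2100000000), 
    (61510, 1400000000), (61518, 350000000), (61568, 4200000000), (61570, 6300000000), (61574, 4200000000), (61582, 1050000000), (61695, 1750000000), 
    (61696, 7000000000), (61698, 10500000000), (61702, 7000000000), (61710, 1750000000), (61951, 1750000000), (61952, 7000000000), 
    (61954, 10500000000), (61958, 7000000000), (61966, 1750000000), (62463, 1050000000), (62464, 4200000000), (62466, 6300000000), 
    (62470, 4200000000), (62478, 1050000000), (63487, 350000000), (63488, 1400000000), (63490, 2100000000), (63494, 1400000000), (63502, 350000000), 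
    (65535, 50000000), (65536, 200000000), (65538, 300000000), (65542, 200000000), (65550, 50000000), (16781313, 49716719), (16781327, -50000000)]

/-- **The digest of part 10 is `twelveSevenSymP10D`** (kernel evaluation of the part's 3636 contributions). -/
theorem twelveSevenSymP10_digest : twelveSevenSymP10.digest 20 = twelveSevenSymP10D := by
  decide +kernel

end QCert
end HubOnly

end Summit.CriticalPhenomena.PercolationContinuityZ3.Theorems
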